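import Summits.AtomisticToContinuum.FouriersLaw.Theses.HoelderEscapeProfile
import Summits.AtomisticToContinuum.FouriersLaw.Theorems.HoelderEscapeProfileAbelSpreadCeilingCanonicalTwin
import Summits.AtomisticToContinuum.FouriersLaw.Theorems.HoelderEscapeProfileFibreCalculusStubPolynomialHorizonCone
import Summits.AtomisticToContinuum.FouriersLaw.Theorems.HoelderEscapeProfileFibreCalculusStubWeightedClusteringTransfer
import Summits.AtomisticToContinuum.FouriersLaw.Theorems.HoelderEscapeProfileFibreCalculusStubStaticStructureFactor
import Summits.AtomisticToContinuum.FouriersLaw.Theorems.HoelderEscapeProfileFibreCalculusStubTwiceIntegratedContinuity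
import Literature.MathematicalPhysics.KineticTheory.InfiniteChainGeneratorLipschitz
import Literature.MathematicalPhysics.KineticTheory.TransportRegularityOfMixing
import Literature.MathematicalPhysics.KineticTheory.ZeroWavenumberDataOfClustering
import Literature.MathematicalPhysics.KineticTheory.InfiniteChainTwoPointContinuity
import Literature.MathematicalPhysics.KineticTheory.InfiniteChainEnergyDensityMoments
import Literature.MathematicalPhysics.KineticTheory.InfiniteChainCurrentMoments
import Literature.MathematicalPhysics.KineticTheory.InfiniteChainPartialMomentumReversal
import Literature.MathematicalPhysics.KineticTheory.InfiniteChainShiftInvariantUniqueness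
import Literature.MathematicalPhysics.KineticTheory.InfiniteChainGoodSetSymmetries
import HarnessLib

/-!
# Stub `stub_pulseDissipationCalculus` of line `Sketch` (crux `HoelderEscapeProfile.LocalEnergyHalfHoelder`,
# stmt-AtomisticToContinuum-16008) — the PULSE DISSIPATION CALCULUS, proved for every guarded pair

`--supports stmt-AtomisticToContinuum-16008` (lead `prover-line-stmt-AtomisticToContinuum-16008-0`). The statement is
VERBATIM the registered stub `Holds.stub_pulseDissipationCalculus` of crux `CoercivePulse.LinearSpread` (stmt-15382,
`Cruxes/LinearSpread/Lines/birth.lean`). For `pinnedChain ω₂ lam β γ` (`ω₂, lam, β > 0`), `T > 0`, a shift- and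
reversal-invariant DLR state `μ`, ANY `μ`-preserving dynamics `D`, `h = energyDensityZ`, `m = ∫ h_0`, the pulse
`S(x,t) = ∫ (h_0-m)(h_x∘φ_t-m) dμ` and the response current `F(x,t) = ∫ (h_0-m)(j_x∘φ_t) dμ`: (1) `Σ(1+|x|)|F(x,t)| < ∞`;
(2) `0 < Σ S(x,0)`; (3) `Σ S(x,t) = Σ S(x,0)`; (4) `t ↦ Σ S(x,t)²` and (5) `t ↦ Σ F(x,t)(S(x+1,t)-S(x,t))` continuous;
(6) `Σ S(t₂)² − Σ S(t₁)² = 2∫_{t₁}^{t₂} Σ F(S(x+1)−S(x))`. (The guard `Σ(1+x²)|S| < ∞` and the a.e. shift covariance are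
not used.) Proof — everything deep is in the tree, this file is the assembly:
* canonical reduction: `AbelSpreadCeiling.RegularityCollapse.stub_canonicalTwin` gives `D'` (carrier `bmGood`, measurable,
  identity off `bmGood`, `D'.flow t = D.flow t` a.e.), which has the same `S`, `F` (`pulseDissipationCalculus`);
* `pdc_exists_window_majorant`: polynomial-horizon `L²` cone (`FibreCalculusSketch.stub_polynomialHorizonCone`, BM 2016
  §3) + second-moment clustering transfer (`FibreCalculusSketch.stub_weightedClusteringTransfer`) for the ρ-mixing
  transfer-operator state (= `μ` by uniqueness of the shift-invariant DLR state) ⇒ ONE `(1+x²)`-summable majorant of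
  `|Cov(h_0,(b∘φ_t)∘τ_x)|`, `b ∈ {h_0, j_0}`, on each window `|t| ≤ τ`; homogeneity of the canonical flow makes these
  covariances `S`, `F` ⇒ (1);
* (2) is `FibreCalculusSketch.ssf_staticStructureFactor_energyDensityZ` (`φ_0 = id`);
* `FibreCalculusSketch.tic_integral_mul_sub_energyDensityZ` (pathwise `ḣ_y = j_{y-1} - j_y`, FTC, Fubini) and continuity
  in `t` (Vitali along orbits) give `∂ₜS(y,·) = F(y−1,·) − F(y,·)`; then (3), (6) by termwise integration under the
  windowed majorant and summation by parts on `ℤ`, (4), (5) by the local Weierstrass M-test.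
[cite: ButtaMarchioro2016, §2 Thm 2.1, eq. (2.6) and §3] [cite: BonettoLebowitzReyBellet2000, §5.2 eq. (23)]
[cite: Georgii2011, Thm 10.25 and §11.1]
-/

noncomputable section

open MeasureTheory ProbabilityTheory Filter Set Function
open scoped Topology BigOperators

namespace Summit.AtomisticToContinuum.FouriersLaw.Theorems.LocalEnergyHalfHoelder.NashDoubling

open Literature.MathematicalPhysics.KineticTheory.HeatConduction

/-! ## §1 Real analysis of `ℤ`-indexed function series -/

/-- Points of `[[a, b]]` lie in any symmetric window containing `a` and `b`. [folklore] -/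
theorem pdc_abs_le_of_mem_uIcc {a b s τ : ℝ} (ha : |a| ≤ τ) (hb : |b| ≤ τ) (hs : s ∈ Set.uIcc a b) : |s| ≤ τ := by
  rw [mem_uIcc] at hs; rw [abs_le] at ha hb ⊢
  rcases hs with ⟨h2, h3⟩ | ⟨h2, h3⟩ <;> constructor <;> linarith

/-- **Local Weierstrass M-test**: continuous terms dominated on every window by a summable sequence. [folklore] -/
theorem pdc_continuous_tsum_of_window {f : ℤ → ℝ → ℝ} (hf : ∀ x, Continuous (f x))
    (hb : ∀ τ : ℝ, 0 ≤ τ → ∃ u : ℤ → ℝ, Summable u ∧ ∀ t : ℝ, |t| ≤ τ → ∀ x, |f x t| ≤ u x) :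
    Continuous fun t : ℝ => ∑' x : ℤ, f x t := by
  refine continuous_iff_continuousAt.2 fun t₀ => ?_
  obtain ⟨u, hu, hfu⟩ := hb (|t₀| + 1) (by positivity)
  refine (continuousOn_tsum (s := Ioo (-(|t₀| + 1)) (|t₀| + 1)) (fun x => (hf x).continuousOn) hu
    fun x t ht => ?_).continuousAt (Ioo_mem_nhds (by linarith [neg_abs_le t₀]) (by linarith [le_abs_self t₀]))
  rw [Real.norm_eq_abs]; exact hfu t (abs_le.2 ⟨ht.1.le, ht.2.le⟩) x

/-- **Termwise integration** of a windowed-dominated series of continuous functions. [folklore] -/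
theorem pdc_tsum_intervalIntegral {f : ℤ → ℝ → ℝ} (hf : ∀ x, Continuous (f x)) {a b τ : ℝ} (ha : |a| ≤ τ)
    (hb : |b| ≤ τ) {u : ℤ → ℝ} (hu : Summable u) (hfu : ∀ t : ℝ, |t| ≤ τ → ∀ x, |f x t| ≤ u x) :
    ∑' x : ℤ, ∫ t in a..b, f x t = ∫ t in a..b, ∑' x : ℤ, f x t := by
  have hwin : ∀ t : ℝ, t ∈ Set.uIoc a b → |t| ≤ τ := fun t ht => pdc_abs_le_of_mem_uIcc ha hb (uIoc_subset_uIcc ht)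
  exact (intervalIntegral.hasSum_integral_of_dominated_convergence (μ := volume) (a := a) (b := b)
    (F := fun x t => f x t) (f := fun t => ∑' x : ℤ, f x t) (fun x _ => u x) (fun x => (hf x).aestronglyMeasurable)
    (fun x => Eventually.of_forall fun t ht => by rw [Real.norm_eq_abs]; exact hfu t (hwin t ht) x)
    (Eventually.of_forall fun t _ => hu) intervalIntegrable_const
    (Eventually.of_forall fun t ht => (Summable.of_norm_bounded hu fun x => by
      rw [Real.norm_eq_abs]; exact hfu t (hwin t ht) x).hasSum)).tsum_eq

/-- **Summation by parts on `ℤ`**: `Σ_y S(y)(F(y−1) − F(y)) = Σ_y F(y)(S(y+1) − S(y))`. [folklore] -/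
theorem pdc_tsum_summation_by_parts {S F : ℤ → ℝ} (h1 : Summable fun y => S y * F (y - 1))
    (h2 : Summable fun y => S y * F y) : ∑' y : ℤ, S y * (F (y - 1) - F y) = ∑' y : ℤ, F y * (S (y + 1) - S y) := by
  have h3 : Summable fun y : ℤ => S (y + 1) * F y := by
    have e : (fun y : ℤ => S (y + 1) * F y) = (fun y : ℤ => S y * F (y - 1)) ∘ Equiv.addRight (1 : ℤ) := by
      funext y; simp
    rw [e]; exact h1.comp_injective (Equiv.injective _)
  have hre : ∑' y : ℤ, S y * F (y - 1) = ∑' y : ℤ, S (y + 1) * F y := by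
    rw [← (Equiv.addRight (1 : ℤ)).tsum_eq (fun y : ℤ => S y * F (y - 1))]
    exact tsum_congr fun y => by simp
  calc ∑' y : ℤ, S y * (F (y - 1) - F y) = ∑' y : ℤ, (S y * F (y - 1) - S y * F y) := tsum_congr fun y => by ring
    _ = (∑' y : ℤ, S (y + 1) * F y) - ∑' y : ℤ, S y * F y := by rw [h1.tsum_sub h2, hre]
    _ = ∑' y : ℤ, F y * (S (y + 1) - S y) := by rw [← h3.tsum_sub h2]; exact tsum_congr fun y => by ring

/-- `1 + |x| ≤ 1 + x²` for an integer `x`. [folklore] -/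
theorem pdc_one_add_abs_le_one_add_sq (x : ℤ) : 1 + |(x : ℝ)| ≤ 1 + (x : ℝ) ^ 2 := by
  rcases eq_or_ne x 0 with rfl | hx
  · simp
  · have h1 : (1 : ℝ) ≤ |(x : ℝ)| := by exact_mod_cast Int.one_le_abs hx
    nlinarith [sq_abs (x : ℝ), abs_nonneg (x : ℝ)]

/-- A non-negative sequence dominated with the weight `1 + x²`: summable, and termwise below its total. [folklore] -/
theorem pdc_summable_of_weighted {M : ℤ → ℝ} (h0 : ∀ x, 0 ≤ M x) (hM : Summable fun x : ℤ => (1 + (x : ℝ) ^ 2) * M x) :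
    Summable M ∧ ∀ x, M x ≤ ∑' y : ℤ, M y := by
  have hs : Summable M := Summable.of_nonneg_of_le h0 (fun x => by nlinarith [h0 x, sq_nonneg (x : ℝ)]) hM
  exact ⟨hs, fun x => hs.le_tsum x fun y _ => h0 y⟩

/-- Fourth powers of an `L⁴` function on a finite measure space are integrable. [folklore] -/
theorem pdc_integrable_pow_four {α : Type*} [MeasurableSpace α] {μ : Measure α} [IsFiniteMeasure μ] {f : α → ℝ}
    (hf : MemLp f 4 μ) : Integrable (fun a => f a ^ 4) μ :=
  (hf.integrable_norm_pow' (p := 4)).congr (Eventually.of_forall fun a => by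
    simp only [Real.norm_eq_abs]; exact Even.pow_abs (by decide) _)

/-- Shifted summability on `ℤ`: `y ↦ u (y - k)`. [folklore] -/
theorem pdc_summable_sub {u : ℤ → ℝ} (hu : Summable u) (k : ℤ) : Summable fun y : ℤ => u (y - k) := by
  simpa [Function.comp_def] using (Equiv.subRight k).summable_iff.2 hu

/-! ## §2 Windowed weighted clustering majorants for the canonical dynamics -/

/-- **Windowed weighted clustering majorant.** Pinned chain (`ω₂, lam, β > 0`), shift-invariant DLR state `μ` at `T > 0`,
a dynamics `D` with carrier BM's good set and measurable flow maps, a box-local (`[-1,1]`) `a ∈ L²` and a box-local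
`b ∈ L² ∩ L⁴` polynomially Lipschitz in the coordinates at `-1, 0, 1`: on every window `|t| ≤ τ` ONE `(1+x²)`-summable
`M ≥ 0` majorises `x ↦ |Cov_μ(a, (b ∘ φ_t) ∘ τ_x)|` (cone `stub_polynomialHorizonCone` + transfer
`stub_weightedClusteringTransfer`, for the ρ-mixing transfer-operator state, which `μ` is by uniqueness). [folklore] -/
theorem pdc_exists_window_majorant {ω₂ lam β : ℝ} (γ : ℝ) (hω : 0 < ω₂) (hl : 0 < lam) (hβ : 0 < β) {T : ℝ} (hT : 0 < T)
    {μ : Measure ChainConfig} (hG : (pinnedChain ω₂ lam β γ).IsChainGibbsMeasure T μ) (hSI : IsShiftInvariant μ)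
    (D : InfiniteChainDynamics (pinnedChain ω₂ lam β γ)) (hcar : D.carrier = (pinnedChain ω₂ lam β γ).bmGood)
    (hmeas : ∀ t : ℝ, Measurable (D.flow t)) {a b : ChainConfig → ℝ} (ham : Measurable a)
    (had : DependsOn a (Set.Icc (-1 : ℤ) 1)) (ha2 : MemLp a 2 μ) (hbm : Measurable b)
    (hbd : DependsOn b (Set.Icc (-1 : ℤ) 1)) (hb2 : MemLp b 2 μ) (hb4 : Integrable (fun σ => b σ ^ 4) μ) {Cb : ℝ}
    {db : ℕ} (hCb : 0 ≤ Cb) (hLip : ∀ (σ σ' : ChainConfig) (R δ : ℝ), 1 ≤ R → 0 ≤ δ → δ ≤ 1 →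
      (∀ i : ℤ, -1 ≤ i → i ≤ 1 → |(σ' i).1| ≤ R ∧ |(σ' i).2| ≤ R ∧ |(σ i).1 - (σ' i).1| ≤ δ ∧ |(σ i).2 - (σ' i).2| ≤ δ) →
      |b σ - b σ'| ≤ Cb * R ^ db * δ) (τ : ℝ) (hτ : 0 ≤ τ) :
    ∃ M : ℤ → ℝ, Summable (fun x : ℤ => (1 + (x : ℝ) ^ 2) * M x) ∧ (∀ x, 0 ≤ M x) ∧ Summable M ∧
      (∀ x, M x ≤ ∑' y : ℤ, M y) ∧ ∀ t : ℝ, |t| ≤ τ → ∀ x : ℤ, |cov[a, (b ∘ D.flow t) ∘ chainShift x; μ]| ≤ M x := by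
  -- the shift-invariant DLR state is the exponentially mixing transfer-operator state (uniqueness)
  obtain ⟨μ', hG', hS', hss, -, C, m, hm, hmix⟩ :=
    MourreDissolution.exists_gibbsState_mixing_pinnedChain ω₂ lam β γ hω hl.le hβ.le T hT
  obtain rfl : μ = μ' :=
    OscillatorChain.eq_of_isChainGibbsMeasure_of_isShiftInvariant_pinnedChain γ hω hl.le hβ.le hT hG hSI hG' hS'
  haveI : IsProbabilityMeasure μ := hss.1
  have hD : D.PreservesMeasure μ := OscillatorChain.preservesMeasure_of_carrier_eq_bmGood (by norm_num) (by norm_num)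
    (OscillatorChain.pinnedChain_isEvenPolyOfDegree_U β γ hω.le hl) (OscillatorChain.pinnedChain_isEvenPolyOfDegree_V ω₂ lam γ hβ)
    D hcar hmeas hG hss
  -- the polynomial-horizon `L²` cone of `b` on the window, fed into the weighted clustering transfer for `a`
  obtain ⟨A, mA, hcone⟩ := FibreCalculusSketch.stub_polynomialHorizonCone ω₂ lam β γ hω hl hβ T hT μ hG hSI D hcar hmeas
    b hbm hbd hb2 hb4 Cb db hCb hLip
  obtain ⟨ε, hε0, hεs, -, happ⟩ := hcone τ hτ
  obtain ⟨B, hB⟩ := FibreCalculusSketch.stub_weightedClusteringTransfer μ inferInstance C m hm hmix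
    hSI.measurePreserving_chainShift a 1 (by simpa using had) ham ha2 1 (Real.sqrt (∫ σ, b σ ^ 2 ∂μ)) (Real.sqrt_nonneg _)
  obtain ⟨M, hMs, -, hMb⟩ := hB ε hε0 hεs
  have hb : ∀ t : ℝ, |t| ≤ τ → ∀ x : ℤ, |cov[a, (b ∘ D.flow t) ∘ chainShift x; μ]| ≤ M x := by
    refine fun t ht x => hMb (b ∘ D.flow t) (hbm.comp (hmeas t)) (hb2.comp_measurePreserving (hD.2 t)) (le_of_eq ?_)
      (fun n => ?_) x
    · congr 1
      exact integral_comp_eq_of_measurePreserving (hD.2 t) (hbm.pow_const 2)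
    · obtain ⟨g, hg1, hg2, hg3, hg4⟩ := happ t ht n
      refine ⟨g, ?_, hg2, hg3, hg4⟩
      have e : Set.Icc (-((n + 1 : ℕ) : ℤ)) ((n + 1 : ℕ) : ℤ) = Set.Icc (-(n : ℤ) - 1) (n + 1) := by push_cast; rw [neg_add']
      rw [e]; exact hg1
  have h0 : ∀ x, 0 ≤ M x := fun x => (abs_nonneg _).trans (hb 0 (by simpa using hτ) x)
  exact ⟨M, hMs, h0, (pdc_summable_of_weighted h0 hMs).1, (pdc_summable_of_weighted h0 hMs).2, hb⟩

/-! ## §3 The pulse dissipation calculus for the canonical dynamics -/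

/-- **All six clauses for the canonical dynamics** (carrier BM's good set, measurable flow maps, identity off the good
set), with `h = energyDensityZ`, `m = ∫ h_0`, `S x t = ∫ (h_0-m)(h_x∘φ_t-m)`, `F x t = ∫ (h_0-m)(j_x∘φ_t)`. [folklore] -/
theorem pdc_canonical {ω₂ lam β : ℝ} (γ : ℝ) (hω : 0 < ω₂) (hl : 0 < lam) (hβ : 0 < β) {T : ℝ} (hT : 0 < T)
    {μ : Measure ChainConfig} (hG : (pinnedChain ω₂ lam β γ).IsChainGibbsMeasure T μ) (hSI : IsShiftInvariant μ)
    (D : InfiniteChainDynamics (pinnedChain ω₂ lam β γ)) (hcar : D.carrier = (pinnedChain ω₂ lam β γ).bmGood)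
    (hmeas : ∀ t : ℝ, Measurable (D.flow t))
    (hid : ∀ (t : ℝ) (σ : ChainConfig), σ ∉ (pinnedChain ω₂ lam β γ).bmGood → D.flow t σ = σ) (S F : ℤ → ℝ → ℝ)
    (hS : S = fun (x : ℤ) (t : ℝ) => ∫ σ, ((pinnedChain ω₂ lam β γ).energyDensityZ σ 0 -
      ∫ σ', (pinnedChain ω₂ lam β γ).energyDensityZ σ' 0 ∂μ) * ((pinnedChain ω₂ lam β γ).energyDensityZ (D.flow t σ) x -
      ∫ σ', (pinnedChain ω₂ lam β γ).energyDensityZ σ' 0 ∂μ) ∂μ)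
    (hF : F = fun (x : ℤ) (t : ℝ) => ∫ σ, ((pinnedChain ω₂ lam β γ).energyDensityZ σ 0 -
      ∫ σ', (pinnedChain ω₂ lam β γ).energyDensityZ σ' 0 ∂μ) * (pinnedChain ω₂ lam β γ).bondCurrentZ (D.flow t σ) x ∂μ) :
    (∀ t : ℝ, Summable (fun x : ℤ => (1 + |(x : ℝ)|) * |F x t|)) ∧ (0 < ∑' x : ℤ, S x 0) ∧
    (∀ t : ℝ, ∑' x : ℤ, S x t = ∑' x : ℤ, S x 0) ∧ Continuous (fun t : ℝ => ∑' x : ℤ, (S x t) ^ 2) ∧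
    Continuous (fun t : ℝ => ∑' x : ℤ, F x t * (S (x + 1) t - S x t)) ∧
    (∀ t₁ t₂ : ℝ, (∑' x : ℤ, (S x t₂) ^ 2) - (∑' x : ℤ, (S x t₁) ^ 2) =
      2 * ∫ s in t₁..t₂, ∑' x : ℤ, F x s * (S (x + 1) s - S x s)) := by
  -- the chain data and the superstable state
  have hU1 := OscillatorChain.pinnedChain_isEvenPolyOfDegree_U β γ hω.le hl
  have hV1 := OscillatorChain.pinnedChain_isEvenPolyOfDegree_V ω₂ lam γ hβ
  have hU0 : ∀ r, 0 ≤ (pinnedChain ω₂ lam β γ).U r := OscillatorChain.pinnedChain_U_nonneg β γ hω.le hl.le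
  have hV0 : ∀ r, 0 ≤ (pinnedChain ω₂ lam β γ).V r := OscillatorChain.pinnedChain_V_nonneg ω₂ lam γ hβ.le
  have hUm := OscillatorChain.measurable_pinnedChain_U ω₂ lam β γ
  have hVm := OscillatorChain.measurable_pinnedChain_V ω₂ lam β γ
  have hVc' : Continuous (deriv (pinnedChain ω₂ lam β γ).V) := hV1.contDiff_two.continuous_deriv (by norm_num)
  have hss : (pinnedChain ω₂ lam β γ).HasSuperstabilityEstimate μ :=
    OscillatorChain.hasSuperstabilityEstimate_of_isShiftInvariant_pinnedChain γ hω hl.le hβ.le hT hG hSI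
  haveI : IsProbabilityMeasure μ := hss.1
  have hD : D.PreservesMeasure μ :=
    OscillatorChain.preservesMeasure_of_carrier_eq_bmGood (by norm_num) (by norm_num) hU1 hV1 D hcar hmeas hG hss
  -- the generators `h_z`, `j_z`: measurability and moments
  have hEm : ∀ z : ℤ, Measurable fun σ : ChainConfig => (pinnedChain ω₂ lam β γ).energyDensityZ σ z := (pinnedChain ω₂ lam β γ).measurable_energyDensityZ hUm hVm
  have hJm : ∀ z : ℤ, Measurable fun σ : ChainConfig => (pinnedChain ω₂ lam β γ).bondCurrentZ σ z := measurable_bondCurrentZ _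
  have hE2 : ∀ z : ℤ, MemLp (fun σ => (pinnedChain ω₂ lam β γ).energyDensityZ σ z) 2 μ := fun z =>
    OscillatorChain.memLp_energyDensityZ_pinnedChain γ hω.le hl.le hβ.le hss z (by norm_num)
  have hE4 : ∀ z : ℤ, MemLp (fun σ => (pinnedChain ω₂ lam β γ).energyDensityZ σ z) 4 μ := fun z =>
    OscillatorChain.memLp_energyDensityZ_pinnedChain γ hω.le hl.le hβ.le hss z (by norm_num)
  have hJ2 : ∀ z : ℤ, MemLp (fun σ => (pinnedChain ω₂ lam β γ).bondCurrentZ σ z) 2 μ := fun z =>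
    OscillatorChain.memLp_bondCurrentZ_pinnedChain γ hω.le hl.le hβ hss z (by norm_num)
  have hJ4 : ∀ z : ℤ, MemLp (fun σ => (pinnedChain ω₂ lam β γ).bondCurrentZ σ z) 4 μ := fun z =>
    OscillatorChain.memLp_bondCurrentZ_pinnedChain γ hω.le hl.le hβ hss z (by norm_num)
  set m : ℝ := ∫ σ', (pinnedChain ω₂ lam β γ).energyDensityZ σ' 0 ∂μ with hm
  have hfm : Measurable fun σ => (pinnedChain ω₂ lam β γ).energyDensityZ σ 0 - m := (hEm 0).sub_const m
  have hf2 : MemLp (fun σ => (pinnedChain ω₂ lam β γ).energyDensityZ σ 0 - m) 2 μ := (hE2 0).sub (memLp_const m)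
  have hf4 : Integrable (fun σ => ((pinnedChain ω₂ lam β γ).energyDensityZ σ 0 - m) ^ 4) μ := pdc_integrable_pow_four ((hE4 0).sub (memLp_const m))
  -- one-point functions: `∫ h_x∘φ_t = m`, `∫ j_x∘φ_t = 0`
  have hintEflow : ∀ (x : ℤ) (t : ℝ), ∫ σ, (pinnedChain ω₂ lam β γ).energyDensityZ (D.flow t σ) x ∂μ = m := fun x t => by
    rw [integral_comp_eq_of_measurePreserving (hD.2 t) (hEm x), hm,
      ← integral_comp_eq_of_measurePreserving (hSI.measurePreserving_chainShift x) (hEm 0)]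
    exact integral_congr_ae (Eventually.of_forall fun σ => by simp only [OscillatorChain.energyDensityZ_chainShift, zero_add])
  have hintJflow : ∀ (x : ℤ) (t : ℝ), ∫ σ, (pinnedChain ω₂ lam β γ).bondCurrentZ (D.flow t σ) x ∂μ = 0 := fun x t => by
    rw [integral_comp_eq_of_measurePreserving (hD.2 t) (hJm x)]; exact hG.integral_bondCurrentZ_eq_zero x
  -- (a) windowed majorants of `S`, `F`: they are covariances of translates, by homogeneity of the canonical flow
  obtain ⟨Ch, hCh, hLh⟩ := OscillatorChain.exists_polyLipschitz_energyDensityZ hU1 hV1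
  obtain ⟨Cj, hCj, hLj⟩ := OscillatorChain.exists_polyLipschitz_bondCurrentZ (P := pinnedChain ω₂ lam β γ) hV1
  have hWS : ∀ τ : ℝ, 0 ≤ τ → ∃ M : ℤ → ℝ, Summable (fun x : ℤ => (1 + (x : ℝ) ^ 2) * M x) ∧ (∀ x, 0 ≤ M x) ∧
      Summable M ∧ (∀ x, M x ≤ ∑' y : ℤ, M y) ∧ ∀ t : ℝ, |t| ≤ τ → ∀ x : ℤ, |S x t| ≤ M x := by
    intro τ hτ
    obtain ⟨M, h1, h2, h3, h4, hb⟩ := pdc_exists_window_majorant γ hω hl hβ hT hG hSI D hcar hmeas (hEm 0)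
      (OscillatorChain.dependsOn_energyDensityZ_zero _) (hE2 0) (hEm 0) (OscillatorChain.dependsOn_energyDensityZ_zero _)
      (hE2 0) (pdc_integrable_pow_four (hE4 0)) hCh hLh τ hτ
    refine ⟨M, h1, h2, h3, h4, fun t ht x => le_of_eq_of_le ?_ (hb t ht x)⟩
    have hY : ((fun σ => (pinnedChain ω₂ lam β γ).energyDensityZ σ 0) ∘ D.flow t) ∘ chainShift x = fun σ => (pinnedChain ω₂ lam β γ).energyDensityZ (D.flow t σ) x := by
      funext σ; simp only [comp_apply]
      rw [D.flow_chainShift_of_eq_id hcar hid hU0 hV0 t x σ, OscillatorChain.energyDensityZ_chainShift, zero_add]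
    rw [hY, ProbabilityTheory.covariance, hS]; simp only [hintEflow x t]; rw [← hm]
  have hWF : ∀ τ : ℝ, 0 ≤ τ → ∃ M : ℤ → ℝ, Summable (fun x : ℤ => (1 + (x : ℝ) ^ 2) * M x) ∧ (∀ x, 0 ≤ M x) ∧
      Summable M ∧ (∀ x, M x ≤ ∑' y : ℤ, M y) ∧ ∀ t : ℝ, |t| ≤ τ → ∀ x : ℤ, |F x t| ≤ M x := by
    intro τ hτ
    obtain ⟨M, h1, h2, h3, h4, hb⟩ := pdc_exists_window_majorant γ hω hl hβ hT hG hSI D hcar hmeas (hEm 0)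
      (OscillatorChain.dependsOn_energyDensityZ_zero _) (hE2 0) (hJm 0) (OscillatorChain.dependsOn_bondCurrentZ_zero _)
      (hJ2 0) (pdc_integrable_pow_four (hJ4 0)) hCj hLj τ hτ
    refine ⟨M, h1, h2, h3, h4, fun t ht x => le_of_eq_of_le ?_ (hb t ht x)⟩
    have hY : ((fun σ => (pinnedChain ω₂ lam β γ).bondCurrentZ σ 0) ∘ D.flow t) ∘ chainShift x = fun σ => (pinnedChain ω₂ lam β γ).bondCurrentZ (D.flow t σ) x := by
      funext σ; simp only [comp_apply]
      rw [D.flow_chainShift_of_eq_id hcar hid hU0 hV0 t x σ, OscillatorChain.bondCurrentZ_chainShift, zero_add]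
    rw [hY, ProbabilityTheory.covariance, hF]; simp only [hintJflow x t, sub_zero]; rw [← hm]
  -- (b) continuity in time (Vitali along orbits)
  have hScont : ∀ x : ℤ, Continuous (S x) := fun x => by
    rw [hS]
    exact D.continuous_integral_mul_comp_flow hD hfm ((hEm x).sub_const m) hf4
      (pdc_integrable_pow_four ((hE4 x).sub (memLp_const m)))
      fun σ hσ => (D.continuous_energyDensityZ_flow hU1.contDiff_two.continuous hV1.contDiff_two.continuous hσ x).sub
        continuous_const
  have hFcont : ∀ x : ℤ, Continuous (F x) := fun x => by
    rw [hF]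
    exact D.continuous_integral_mul_comp_flow hD hfm (hJm x) hf4 (pdc_integrable_pow_four (hJ4 x))
      fun σ hσ => D.continuous_bondCurrentZ_flow hVc' hσ x
  -- (c) the once-integrated local conservation law and the derivative of `S(y,·)`
  have hlaw : ∀ (y : ℤ) (a b : ℝ), S y b - S y a = ∫ s in a..b, (F (y - 1) s - F y s) := by
    intro y a b
    have h := FibreCalculusSketch.tic_integral_mul_sub_energyDensityZ D hD (hU1.contDiff_two.differentiable (by simp))
      (hV1.contDiff_two.differentiable (by simp)) hVc' hJ2
      (FibreCalculusSketch.tic_measurable_uncurry_bondCurrentZ_flow D hcar hmeas hid hVc') hfm hf2 y a b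
    have hi : ∀ t : ℝ, Integrable (fun σ => ((pinnedChain ω₂ lam β γ).energyDensityZ σ 0 - m) * ((pinnedChain ω₂ lam β γ).energyDensityZ (D.flow t σ) y - m)) μ :=
      fun t => hf2.integrable_mul (((hE2 y).comp_measurePreserving (hD.2 t)).sub (memLp_const m))
    rw [hS, hF]; simp only; rw [← integral_sub (hi b) (hi a), ← h]
    exact integral_congr_ae (Eventually.of_forall fun σ => by ring)
  have hderiv : ∀ (y : ℤ) (t : ℝ), HasDerivAt (S y) (F (y - 1) t - F y t) t := by
    intro y t
    have e : S y = fun u => S y 0 + ∫ s in (0:ℝ)..u, (F (y - 1) s - F y s) := by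
      funext u; have := hlaw y 0 u; linarith
    rw [e]
    exact (((hFcont (y - 1)).sub (hFcont y)).integral_hasStrictDerivAt 0 t).hasDerivAt.const_add _
  refine ⟨fun t => ?_, ?_, fun t => ?_, ?_, ?_, fun t₁ t₂ => ?_⟩
  · -- (1) weighted summability of the response current (`1 + |x| ≤ 1 + x²`)
    obtain ⟨M, hM, h0, -, -, hb⟩ := hWF |t| (abs_nonneg t)
    exact Summable.of_nonneg_of_le (fun x => by positivity) (fun x => (mul_le_mul_of_nonneg_right
      (pdc_one_add_abs_le_one_add_sq x) (abs_nonneg _)).trans (mul_le_mul_of_nonneg_left (hb t le_rfl x) (by positivity))) hM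
  · -- (2) `χ = Σ S(x,0) > 0`: statics of the energy density (`φ_0 = id`)
    have h2 := (FibreCalculusSketch.ssf_staticStructureFactor_energyDensityZ γ hω hl.le hβ.le hT hG hSI).2
    rw [hS]; simp only [D.flow_zero_of_eq_id hcar hid]; exact h2
  · -- (3) conservation: integrate `∂ₜS(y) = F(y-1) - F(y)` on `[0,t]` termwise and telescope
    obtain ⟨MS, -, -, hMSs, -, hbS⟩ := hWS |t| (abs_nonneg t)
    obtain ⟨MF', -, -, hMFs, -, hbF⟩ := hWF |t| (abs_nonneg t)
    have hex := pdc_tsum_intervalIntegral (f := fun y s => F (y - 1) s - F y s) (fun y => (hFcont (y - 1)).sub (hFcont y))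
      (a := 0) (b := t) (τ := |t|) (by simp) le_rfl ((pdc_summable_sub hMFs 1).add hMFs)
      fun s hs y => (abs_sub _ _).trans (add_le_add (hbF s hs (y - 1)) (hbF s hs y))
    have hzero : ∀ s : ℝ, |s| ≤ |t| → ∑' y : ℤ, (F (y - 1) s - F y s) = 0 := by
      intro s hs
      have h2 : Summable fun y : ℤ => F y s :=
        Summable.of_norm_bounded hMFs fun y => by rw [Real.norm_eq_abs]; exact hbF s hs y
      rw [(pdc_summable_sub h2 1).tsum_sub h2, sub_eq_zero]
      exact (Equiv.subRight (1 : ℤ)).tsum_eq (fun y => F y s)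
    have hSum : ∀ u : ℝ, |u| ≤ |t| → Summable fun y : ℤ => S y u := fun u hu =>
      Summable.of_norm_bounded hMSs fun y => by rw [Real.norm_eq_abs]; exact hbS u hu y
    have hdiff : ∑' y : ℤ, (S y t - S y 0) = 0 := by
      calc ∑' y : ℤ, (S y t - S y 0) = ∑' y : ℤ, ∫ s in (0:ℝ)..t, (F (y - 1) s - F y s) := tsum_congr fun y => hlaw y 0 t
        _ = ∫ s in (0:ℝ)..t, (0 : ℝ) := by
            rw [hex]; exact intervalIntegral.integral_congr fun s hs => hzero s (pdc_abs_le_of_mem_uIcc (by simp) le_rfl hs)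
        _ = 0 := by simp
    rw [(hSum t le_rfl).tsum_sub (hSum 0 (by simp))] at hdiff
    linarith
  · -- (4) continuity of `t ↦ Σ S(x,t)²` (local M-test)
    refine pdc_continuous_tsum_of_window (fun x => (hScont x).pow 2) fun τ hτ => ?_
    obtain ⟨MS, -, hMS0, hMSs, hle, hbS⟩ := hWS τ hτ
    refine ⟨fun x => (∑' y : ℤ, MS y) * MS x, hMSs.mul_left _, fun t ht x => ?_⟩
    rw [abs_pow, sq]
    exact mul_le_mul ((hbS t ht x).trans (hle x)) (hbS t ht x) (abs_nonneg _) (tsum_nonneg hMS0)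
  · -- (5) continuity of `t ↦ Σ F(x,t)(S(x+1,t) - S(x,t))`
    refine pdc_continuous_tsum_of_window (fun x => (hFcont x).mul ((hScont (x + 1)).sub (hScont x))) fun τ hτ => ?_
    obtain ⟨MS, -, hMS0, hMSs, hle, hbS⟩ := hWS τ hτ
    obtain ⟨MF', -, hMF0, hMFs, -, hbF⟩ := hWF τ hτ
    refine ⟨fun x => MF' x * (2 * ∑' y : ℤ, MS y), hMFs.mul_right _, fun t ht x => ?_⟩
    rw [abs_mul]
    refine mul_le_mul (hbF t ht x) ?_ (abs_nonneg _) (hMF0 x)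
    calc |S (x + 1) t - S x t| ≤ |S (x + 1) t| + |S x t| := abs_sub _ _
      _ ≤ (∑' y : ℤ, MS y) + ∑' y : ℤ, MS y := add_le_add ((hbS t ht (x + 1)).trans (hle (x + 1))) ((hbS t ht x).trans (hle x))
      _ = 2 * ∑' y : ℤ, MS y := by ring
  · -- (6) the dissipation identity: termwise FTC for `S(y)²`, exchange under the majorant, summation by parts
    obtain ⟨MS, -, hMS0, hMSs, hle, hbS⟩ := hWS (max |t₁| |t₂|) (le_max_of_le_left (abs_nonneg t₁))
    obtain ⟨MF', -, hMF0, hMFs, -, hbF⟩ := hWF (max |t₁| |t₂|) (le_max_of_le_left (abs_nonneg t₁))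
    have ht₁ : |t₁| ≤ max |t₁| |t₂| := le_max_left _ _
    have ht₂ : |t₂| ≤ max |t₁| |t₂| := le_max_right _ _
    have hSt0 : 0 ≤ ∑' y : ℤ, MS y := tsum_nonneg hMS0
    -- products `S(y,s) G(y)` with `|G| ≤ MF'(· - k)` are summable on the window
    have hprod : ∀ s : ℝ, |s| ≤ max |t₁| |t₂| → ∀ (G : ℤ → ℝ) (k : ℤ), (∀ y, |G y| ≤ MF' (y - k)) →
        Summable fun y : ℤ => S y s * G y := fun s hs G k hGb =>
      Summable.of_norm_bounded ((pdc_summable_sub hMFs k).mul_left (∑' y : ℤ, MS y)) fun y => by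
        rw [Real.norm_eq_abs, abs_mul]
        exact mul_le_mul ((hbS s hs y).trans (hle y)) (hGb y) (abs_nonneg _) hSt0
    have hfc : ∀ y : ℤ, Continuous fun s => 2 * (S y s * (F (y - 1) s - F y s)) := fun y =>
      continuous_const.mul ((hScont y).mul ((hFcont (y - 1)).sub (hFcont y)))
    have hex := pdc_tsum_intervalIntegral (f := fun y s => 2 * (S y s * (F (y - 1) s - F y s))) hfc ht₁ ht₂
      ((((pdc_summable_sub hMFs 1).add hMFs).mul_left _).mul_left 2) fun s hs y => by
        rw [abs_mul, abs_two, abs_mul]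
        exact mul_le_mul_of_nonneg_left (mul_le_mul ((hbS s hs y).trans (hle y))
          ((abs_sub _ _).trans (add_le_add (hbF s hs (y - 1)) (hbF s hs y))) (abs_nonneg _) hSt0) zero_le_two
    have hFTC : ∀ y : ℤ, ∫ s in t₁..t₂, 2 * (S y s * (F (y - 1) s - F y s)) = S y t₂ ^ 2 - S y t₁ ^ 2 := by
      intro y
      have hd : ∀ s : ℝ, HasDerivAt (S y * S y) (2 * (S y s * (F (y - 1) s - F y s))) s := fun s =>
        ((hderiv y s).mul (hderiv y s)).congr_deriv (by ring)
      rw [intervalIntegral.integral_eq_sub_of_hasDerivAt (fun s _ => hd s) ((hfc y).intervalIntegrable _ _)]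
      simp only [Pi.mul_apply]; ring
    have hsq : ∀ t : ℝ, |t| ≤ max |t₁| |t₂| → Summable fun y : ℤ => S y t ^ 2 := fun t ht =>
      Summable.of_norm_bounded (hMSs.mul_left (∑' y : ℤ, MS y)) fun y => by
        rw [Real.norm_eq_abs, abs_pow, sq]
        exact mul_le_mul ((hbS t ht y).trans (hle y)) (hbS t ht y) (abs_nonneg _) hSt0
    have hparts : ∀ s : ℝ, |s| ≤ max |t₁| |t₂| →
        ∑' y : ℤ, 2 * (S y s * (F (y - 1) s - F y s)) = 2 * ∑' y : ℤ, F y s * (S (y + 1) s - S y s) := fun s hs => by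
      rw [tsum_mul_left, pdc_tsum_summation_by_parts (S := fun y => S y s) (F := fun y => F y s)
        (hprod s hs (fun y => F (y - 1) s) 1 fun y => hbF s hs (y - 1))
        (hprod s hs (fun y => F y s) 0 fun y => by simpa using hbF s hs y)]
    calc (∑' x : ℤ, S x t₂ ^ 2) - ∑' x : ℤ, S x t₁ ^ 2 = ∑' y : ℤ, (S y t₂ ^ 2 - S y t₁ ^ 2) :=
          ((hsq t₂ ht₂).tsum_sub (hsq t₁ ht₁)).symm
      _ = ∫ s in t₁..t₂, ∑' y : ℤ, 2 * (S y s * (F (y - 1) s - F y s)) := by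
          rw [← hex]; exact tsum_congr fun y => (hFTC y).symm
      _ = ∫ s in t₁..t₂, 2 * ∑' y : ℤ, F y s * (S (y + 1) s - S y s) :=
          intervalIntegral.integral_congr fun s hs => hparts s (pdc_abs_le_of_mem_uIcc ht₁ ht₂ hs)
      _ = 2 * ∫ s in t₁..t₂, ∑' y : ℤ, F y s * (S (y + 1) s - S y s) := intervalIntegral.integral_const_mul _ _

/-! ## §4 Every guarded dynamics: transfer along the canonical twin, and the registered stub -/

/-- **The pulse dissipation calculus for EVERY guarded pair `(μ, D)` of the pinned chain** (signature verbatim the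
registered stub `stub_pulseDissipationCalculus` of crux `CoercivePulse.LinearSpread`, stmt-15382, and of line `Sketch`
of crux `HoelderEscapeProfile.LocalEnergyHalfHoelder`, stmt-16008): `F`-summability with weight `1+|x|`, `χ > 0`,
conservation, continuity of `t ↦ ΣS²` and `t ↦ ΣF∇S`, and the dissipation identity `ΣS(t₂)² − ΣS(t₁)² = 2∫_{t₁}^{t₂}ΣF∇S`.
Proof: the canonical twin `D'` of `D` (`stub_canonicalTwin`) has the same `S` and `F`, and `pdc_canonical` applies.
[cite: ButtaMarchioro2016, §2 Thm 2.1, eq. (2.6) and §3] [cite: BonettoLebowitzReyBellet2000, §5.2 eq. (23)] -/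
theorem pulseDissipationCalculus : ∀ ω₂ lam β γ : ℝ, 0 < ω₂ → 0 < lam → 0 < β → ∀ T : ℝ, 0 < T → ∀ μ : MeasureTheory.Measure Literature.MathematicalPhysics.KineticTheory.HeatConduction.ChainConfig, (Literature.MathematicalPhysics.KineticTheory.HeatConduction.pinnedChain ω₂ lam β γ).IsChainGibbsMeasure T μ → Literature.MathematicalPhysics.KineticTheory.HeatConduction.IsShiftInvariant μ → μ.map (fun σ : Literature.MathematicalPhysics.KineticTheory.HeatConduction.ChainConfig => fun x : ℤ => ((σ x).1, -(σ x).2)) = μ → ∀ D : Literature.MathematicalPhysics.KineticTheory.HeatConduction.InfiniteChainDynamics (Literature.MathematicalPhysics.KineticTheory.HeatConduction.pinnedChain ω₂ lam β γ), D.PreservesMeasure μ → (∀ t : ℝ, ∀ᵐ σ ∂μ, D.flow t (Literature.MathematicalPhysics.KineticTheory.HeatConduction.shift σ) = Literature.MathematicalPhysics.KineticTheory.HeatConduction.shift (D.flow t σ)) → ∀ h : Literature.MathematicalPhysics.KineticTheory.HeatConduction.ChainConfig → ℤ → ℝ, h = (fun (σ : Literature.MathematicalPhysics.KineticTheory.HeatConduction.ChainConfig)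 (x : ℤ) => (σ x).2 ^ 2 / 2 + (Literature.MathematicalPhysics.KineticTheory.HeatConduction.pinnedChain ω₂ lam β γ).U (σ x).1 + ((Literature.MathematicalPhysics.KineticTheory.HeatConduction.pinnedChain ω₂ lam β γ).V ((σ (x + 1)).1 - (σ x).1) + (Literature.MathematicalPhysics.KineticTheory.HeatConduction.pinnedChain ω₂ lam β γ).V ((σ x).1 - (σ (x - 1)).1)) / 2) → ∀ S : ℤ → ℝ → ℝ, S = (fun (x : ℤ) (t : ℝ) => ∫ σ, (h σ 0 - ∫ σ', h σ' 0 ∂μ) * (h (D.flow t σ) x - ∫ σ', h σ' 0 ∂μ) ∂μ) → ∀ F : ℤ → ℝ → ℝ, F = (fun (x : ℤ) (t : ℝ) => ∫ σ, (h σ 0 - ∫ σ', h σ' 0 ∂μ) * (Literature.MathematicalPhysics.KineticTheory.HeatConduction.pinnedChain ω₂ lam β γ).bondCurrentZ (D.flow t σ) x ∂μ) → (∀ t : ℝ, Summable (fun x : ℤ => (1 + (x : ℝ) ^ 2) * |S x t|)) → (∀ t : ℝ, Summable (fun x : ℤ => (1 + |(x : ℝ)|) * |F x t|)) ∧ (0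 < ∑' x : ℤ, S x 0) ∧ (∀ t : ℝ, ∑' x : ℤ, S x t = ∑' x : ℤ, S x 0) ∧ Continuous (fun t : ℝ => ∑' x : ℤ, (S x t) ^ 2) ∧ Continuous (fun t : ℝ => ∑' x : ℤ, F x t * (S (x + 1) t - S x t)) ∧ (∀ t₁ t₂ : ℝ, (∑' x : ℤ, (S x t₂) ^ 2) - (∑' x : ℤ, (S x t₁) ^ 2) = 2 * ∫ s in t₁..t₂, ∑' x : ℤ, F x s * (S (x + 1) s - S x s)) := by
  intro ω₂ lam β γ hω hl hβ T hT μ hG hSI hR D hP _hShift h hh S hS F hF _hGuard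
  obtain rfl : h = fun σ x => (pinnedChain ω₂ lam β γ).energyDensityZ σ x := hh
  obtain ⟨D', hcar', hmeas', hid', -, hae, -, -⟩ :=
    AbelSpreadCeiling.RegularityCollapse.stub_canonicalTwin ω₂ lam β γ hω hl hβ T hT μ hG hSI hR D hP
  refine pdc_canonical γ hω hl hβ hT hG hSI D' hcar' hmeas' hid' S F ?_ ?_
  · rw [hS]; funext x t; refine integral_congr_ae ?_; filter_upwards [hae t] with σ hσ; simp only [hσ]
  · rw [hF]; funext x t; refine integral_congr_ae ?_; filter_upwards [hae t] with σ hσ; simp only [hσ]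

/-- **Statement of the registered stub `stub_pulseDissipationCalculus`** (verbatim `Stmt.stub_pulseDissipationCalculus` of
the skeleton `Cruxes/LocalEnergyHalfHoelder/Lines/Sketch.lean` = `Holds.stub_pulseDissipationCalculus` of
`Cruxes/LinearSpread/Lines/birth.lean`, in this file's namespace so the skeleton can import it without a clash). -/
abbrev Stmt.stub_pulseDissipationCalculus : Prop :=
    ∀ ω₂ lam β γ : ℝ, 0 < ω₂ → 0 < lam → 0 < β → ∀ T : ℝ, 0 < T → ∀ μ : MeasureTheory.Measure Literature.MathematicalPhysics.KineticTheory.HeatConduction.ChainConfig, (Literature.MathematicalPhysics.KineticTheory.HeatConduction.pinnedChain ω₂ lam β γ).IsChainGibbsMeasure T μ → Literature.MathematicalPhysics.KineticTheory.HeatConduction.IsShiftInvariant μ → μ.map (fun σ : Literature.MathematicalPhysics.KineticTheory.HeatConduction.ChainConfig => fun x : ℤ => ((σ x).1, -(σ x).2)) = μ → ∀ D : Literature.MathematicalPhysics.KineticTheory.HeatConduction.InfiniteChainDynamics (Literature.MathematicalPhysics.KineticTheory.HeatConduction.pinnedChain ω₂ lam β γ), D.PreservesMeasure μ → (∀ t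 : ℝ, ∀ᵐ σ ∂μ, D.flow t (Literature.MathematicalPhysics.KineticTheory.HeatConduction.shift σ) = Literature.MathematicalPhysics.KineticTheory.HeatConduction.shift (D.flow t σ)) → ∀ h : Literature.MathematicalPhysics.KineticTheory.HeatConduction.ChainConfig → ℤ → ℝ, h = (fun (σ : Literature.MathematicalPhysics.KineticTheory.HeatConduction.ChainConfig) (x : ℤ) => (σ x).2 ^ 2 / 2 + (Literature.MathematicalPhysics.KineticTheory.HeatConduction.pinnedChain ω₂ lam β γ).U (σ x).1 + ((Literature.MathematicalPhysics.KineticTheory.HeatConduction.pinnedChain ω₂ lam β γ).V ((σ (x + 1)).1 - (σ x).1) + (Literature.MathematicalPhysics.KineticTheory.HeatConduction.pinnedChain ω₂ lam β γ).V ((σ x).1 - (σ (x - 1)).1)) / 2) → ∀ S : ℤ → ℝ → ℝ, S = (fun (x : ℤ) (t : ℝ) => ∫ σ, (h σ 0 - ∫ σ', h σ' 0 ∂μ) * (h (D.flow t σ) x - ∫ σ', h σ' 0 ∂μ) ∂μ) → ∀ F : ℤ → ℝ → ℝ, F = (fun (x : ℤ) (t : ℝ) => ∫ σ, (h σ 0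 - ∫ σ', h σ' 0 ∂μ) * (Literature.MathematicalPhysics.KineticTheory.HeatConduction.pinnedChain ω₂ lam β γ).bondCurrentZ (D.flow t σ) x ∂μ) → (∀ t : ℝ, Summable (fun x : ℤ => (1 + (x : ℝ) ^ 2) * |S x t|)) → (∀ t : ℝ, Summable (fun x : ℤ => (1 + |(x : ℝ)|) * |F x t|)) ∧ (0 < ∑' x : ℤ, S x 0) ∧ (∀ t : ℝ, ∑' x : ℤ, S x t = ∑' x : ℤ, S x 0) ∧ Continuous (fun t : ℝ => ∑' x : ℤ, (S x t) ^ 2) ∧ Continuous (fun t : ℝ => ∑' x : ℤ, F x t * (S (x + 1) t - S x t)) ∧ (∀ t₁ t₂ : ℝ, (∑' x : ℤ, (S x t₂) ^ 2) - (∑' x : ℤ, (S x t₁) ^ 2) = 2 * ∫ s in t₁..t₂, ∑' x : ℤ, F x s * (S (x + 1) s - S x s))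

/-- **Registered stub `stub_pulseDissipationCalculus`** (type `Stmt.stub_pulseDissipationCalculus`, verbatim the
skeleton's): the pulse dissipation calculus of the guarded pinned chain (`pulseDissipationCalculus`).
[cite: ButtaMarchioro2016, §2 Thm 2.1, eq. (2.6) and §3] [cite: BonettoLebowitzReyBellet2000, §5.2 eq. (23)] -/
theorem stub_pulseDissipationCalculus : Stmt.stub_pulseDissipationCalculus :=
  pulseDissipationCalculus

end Summit.AtomisticToContinuum.FouriersLaw.Theorems.LocalEnergyHalfHoelder.NashDoubling

end
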